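import Mathlib.Algebra.Field.Basic
import Mathlib.Algebra.GroupWithZero.Basic
import Mathlib.Data.Int.Cast.Lemmas
import Mathlib.Data.Nat.ModEq
import Mathlib.Tactic.LinearCombination
import Mathlib.Tactic.Ring
import Mathlib.Tactic.NormNum
import Mathlib.Tactic.Linarith
import Mathlib.Tactic.SplitIfs
import HarnessLib

/-!
# Kernel-checkable monomial-membership certificates (support for the degree-8 scenario method)

The scenario method of [CastryckLaterveerOunaies2012, §2] closes a scenario of the Casas-Alvero problem in
degree `d` and characteristic `p` by showing that a monomial lies in the ideal of the scenario system modulo `p`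
(there: a Gröbner-basis computation in Magma).  This file provides a small *computable* normaliser for sparse
polynomials with coefficients reduced modulo a numeral `p` — terms are pairs `(c, x) : ℕ × ℕ` of a residue `c` and a
packed exponent vector `x = Σ_i e_i 64^i` — together with its soundness theorem `scenClosed_of_check`:
if `check p fuel 64 t [(G_2, E_2), …] (k * 64^tv) = true` (run by the kernel, `decide +kernel`), i.e. the normal
form of `Σ_j G_j E_j` modulo `p` is the single term `x_tv ^ k`, then the system `E_2 = … = 0` has no solution
`v` in a field of characteristic `p` with `v_0, …, v_{t-1} ≠ 0` (`ScenClosed`).  The cofactor lists `G_j` are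
data (packed codes `c * 64^t + x`); nothing about them is trusted.

Used by `Degree8Char419Cert*.lean` / `Degree8Char443Cert*.lean` (lottery cell, `code/L4lean-g15/d8/`).
No `sorry`, no new axioms. [cite: CastryckLaterveerOunaies2012, Sec. 2]
-/

set_option linter.style.longLine false
set_option autoImplicit false

namespace Literature.Algebra.Polynomial.CasasAlvero.CertCheck

/-- A term `(c, x)`: coefficient residue `c`, packed exponent code `x = Σ_i e_i M^i`. [folklore] -/
abbrev T := ℕ × ℕ

section Defs

/-- the `n` lowest base-`M` digits of `x` are all `< b` [folklore] -/
def digitsLT (M b : ℕ) : ℕ → ℕ → Bool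
  | 0, _ => true
  | n + 1, x => decide (x % M < b) && digitsLT M b n (x / M)

/-- multiply the term list `G` by the term `(c, x)` (`c : ℤ`), reducing coefficients modulo `p` [folklore] -/
def smul (p : ℕ) (c : ℤ) (x : ℕ) : List T → List T
  | [] => []
  | g :: gs => (((c * (g.1 : ℤ)) % (p : ℤ)).toNat, x + g.2) :: smul p c x gs

/-- merge two term lists (descending codes), adding coefficients modulo `p` on equal codes and dropping zero
coefficients; `n` is fuel [folklore] -/
def merge (p : ℕ) : ℕ → List T → List T → List T
  | 0, a, b => a ++ b
  | _ + 1, [], b => b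
  | _ + 1, a :: as, [] => a :: as
  | n + 1, (c, x) :: as, (d, y) :: bs =>
    if y < x then (c, x) :: merge p n as ((d, y) :: bs)
    else if x < y then (d, y) :: merge p n ((c, x) :: as) bs
    else if (c + d) % p = 0 then merge p n as bs else ((c + d) % p, x) :: merge p n as bs

/-- unpack a cofactor code `c * X + x` [folklore] -/
def decode (X code : ℕ) : T := (code / X, code % X)

/-- all products `e · G` for the terms `e` of `E`, prepended to `acc` [folklore] -/
def prodsE (p : ℕ) (G : List T) : List (ℤ × ℕ) → List (List T) → List (List T)
  | [], acc => acc
  | (c, x) :: es, acc => prodsE p G es (smul p c x G :: acc)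

/-- all products over all pairs `(G_j, E_j)` [folklore] -/
def prods (p X : ℕ) : List (List ℕ × List (ℤ × ℕ)) → List (List T)
  | [] => []
  | (g, e) :: rest => prodsE p (g.map (decode X)) e (prods p X rest)

/-- one round of pairwise merging [folklore] -/
def mergePairs (p fuel : ℕ) : List (List T) → List (List T)
  | a :: b :: rest => merge p fuel a b :: mergePairs p fuel rest
  | l => l

/-- balanced merging of a list of term lists (`n` rounds of fuel; `[]` if the fuel runs out) [folklore] -/
def mergeAll (p fuel : ℕ) : ℕ → List (List T) → List T
  | 0, _ => []
  | _ + 1, [] => []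
  | _ + 1, [a] => a
  | n + 1, a :: b :: rest => mergeAll p fuel n (mergePairs p fuel (a :: b :: rest))

/-- well-formedness of a term list: all exponent digits `< M / 2` (so that products never carry) [folklore] -/
def wfT (M nv : ℕ) : List T → Bool
  | [] => true
  | (_, x) :: rest => digitsLT M (M / 2) nv x && wfT M nv rest

/-- well-formedness of an equation list [folklore] -/
def wfE (M nv : ℕ) : List (ℤ × ℕ) → Bool
  | [] => true
  | (_, x) :: rest => digitsLT M (M / 2) nv x && wfE M nv rest

/-- well-formedness of all the data [folklore] -/
def wfPairs (M nv X : ℕ) : List (List ℕ × List (ℤ × ℕ)) → Bool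
  | [] => true
  | (g, e) :: rest => wfT M nv (g.map (decode X)) && wfE M nv e && wfPairs M nv X rest

/-- The certificate check: the data are well formed and the normal form of `Σ_j G_j E_j` modulo `p` is the single
term `1 · xt`.  Meant to be evaluated by the kernel (`decide +kernel`). [folklore] -/
def check (p fuel M nv : ℕ) (pairs : List (List ℕ × List (ℤ × ℕ))) (xt : ℕ) : Bool :=
  wfPairs M nv (M ^ nv) pairs && (mergeAll p fuel 64 (prods p (M ^ nv) pairs) == [(1, xt)])

end Defs

section Eval

variable {K : Type*} [CommRing K]

/-- the monomial with packed exponent code `x` on the variables `v i, v (i+1), …, v (i+n-1)` [folklore] -/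
def monoEval (v : ℕ → K) (M : ℕ) : ℕ → ℕ → ℕ → K
  | 0, _, _ => 1
  | n + 1, i, x => v i ^ (x % M) * monoEval v M n (i + 1) (x / M)

/-- evaluation of a term list [folklore] -/
def evalL (v : ℕ → K) (M nv : ℕ) : List T → K
  | [] => 0
  | (c, x) :: rest => (c : K) * monoEval v M nv 0 x + evalL v M nv rest

/-- evaluation of an equation (integer coefficients) [folklore] -/
def evalE (v : ℕ → K) (M nv : ℕ) : List (ℤ × ℕ) → K
  | [] => 0
  | (c, x) :: rest => (c : K) * monoEval v M nv 0 x + evalE v M nv rest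

/-- sum of the evaluations of a list of term lists [folklore] -/
def evalLL (v : ℕ → K) (M nv : ℕ) : List (List T) → K
  | [] => 0
  | l :: ls => evalL v M nv l + evalLL v M nv ls

/-- `Σ_j G_j E_j` [folklore] -/
def evalPairs (v : ℕ → K) (M nv X : ℕ) : List (List ℕ × List (ℤ × ℕ)) → K
  | [] => 0
  | (g, e) :: rest => evalL v M nv (g.map (decode X)) * evalE v M nv e + evalPairs v M nv X rest

/-- no variables: the empty monomial is `1`. [folklore] -/
@[simp] private theorem monoEval_zero_left (v : ℕ → K) (M i x : ℕ) : monoEval v M 0 i x = 1 := rfl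

/-- peel off the lowest digit. [folklore] -/
@[simp] private theorem monoEval_succ (v : ℕ → K) (M n i x : ℕ) :
    monoEval v M (n + 1) i x = v i ^ (x % M) * monoEval v M n (i + 1) (x / M) := rfl

/-- the code `0` is the monomial `1`. [folklore] -/
private theorem monoEval_zero (v : ℕ → K) (M : ℕ) : ∀ n i, monoEval v M n i 0 = 1
  | 0, _ => rfl
  | n + 1, i => by simp [monoEval_zero v M n]

/-- products of monomials: codes add, provided no digit carries. [folklore] -/
private theorem monoEval_add (v : ℕ → K) (M : ℕ) :
    ∀ n i x y, digitsLT M (M / 2) n x = true → digitsLT M (M / 2) n y = true →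
      monoEval v M n i (x + y) = monoEval v M n i x * monoEval v M n i y
  | 0, _, _, _, _, _ => by simp
  | n + 1, i, x, y, hx, hy => by
    simp only [digitsLT, Bool.and_eq_true, decide_eq_true_eq] at hx hy
    have hlt : x % M + y % M < M := by omega
    rw [monoEval_succ, monoEval_succ, monoEval_succ, Nat.add_mod_of_add_mod_lt hlt,
      Nat.add_div_eq_of_add_mod_lt hlt, monoEval_add v M n (i + 1) (x / M) (y / M) hx.2 hy.2, pow_add]
    ring

/-- the code `k * M ^ tv` is the monomial `x_tv ^ k`. [folklore] -/
private theorem monoEval_single (v : ℕ → K) {M : ℕ} (hM : 1 < M) {k : ℕ} (hk : k < M) :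
    ∀ n i tv, tv < n → monoEval v M n i (k * M ^ tv) = v (i + tv) ^ k
  | 0, _, _, h => absurd h (Nat.not_lt_zero _)
  | n + 1, i, 0, _ => by
    simp [Nat.mod_eq_of_lt hk, Nat.div_eq_of_lt hk, monoEval_zero]
  | n + 1, i, tv + 1, h => by
    have h1 : k * M ^ (tv + 1) % M = 0 := by
      rw [pow_succ, ← mul_assoc]; exact Nat.mul_mod_left _ _
    have h2 : k * M ^ (tv + 1) / M = k * M ^ tv := by
      rw [pow_succ, ← mul_assoc, Nat.mul_div_cancel _ (by omega)]
    rw [monoEval_succ, h1, h2, pow_zero, one_mul, monoEval_single v hM hk n (i + 1) tv (by omega)]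
    congr 2; omega

variable {p : ℕ}

/-- reduction modulo `p` is invisible in characteristic `p` (naturals). [folklore] -/
private theorem natCast_mod (hp : (p : K) = 0) (a : ℕ) : ((a % p : ℕ) : K) = (a : K) := by
  conv_rhs => rw [← Nat.mod_add_div a p]
  push_cast
  rw [hp]; ring

/-- reduction modulo `p` is invisible in characteristic `p` (integers). [folklore] -/
private theorem intCast_emod_toNat (hp : (p : K) = 0) (hp0 : 0 < p) (z : ℤ) :
    (((z % (p : ℤ)).toNat : ℕ) : K) = (z : K) := by
  have h0 : 0 ≤ z % (p : ℤ) := Int.emod_nonneg z (by exact_mod_cast hp0.ne')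
  have h1 : (((z % (p : ℤ)).toNat : ℕ) : K) = (((z % (p : ℤ) : ℤ)) : K) := by
    rw [← Int.cast_natCast, Int.toNat_of_nonneg h0]
  rw [h1, Int.emod_def]
  push_cast
  rw [hp]; ring

/-- evaluation is additive over concatenation. [folklore] -/
private theorem evalL_append (v : ℕ → K) (M nv : ℕ) : ∀ a b : List T,
    evalL v M nv (a ++ b) = evalL v M nv a + evalL v M nv b
  | [], b => by simp [evalL]
  | (c, x) :: as, b => by rw [List.cons_append, evalL, evalL, evalL_append v M nv as b]; ring

/-- `merge` preserves the total evaluation (any inputs, sorted or not). [folklore] -/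
private theorem evalL_merge (hp : (p : K) = 0) (v : ℕ → K) (M nv : ℕ) : ∀ n (a b : List T),
    evalL v M nv (merge p n a b) = evalL v M nv a + evalL v M nv b
  | 0, a, b => by simp [merge, evalL_append]
  | n + 1, [], b => by simp [merge, evalL]
  | n + 1, t :: as, [] => by simp [merge, evalL]
  | n + 1, (c, x) :: as, (d, y) :: bs => by
    simp only [merge]
    split_ifs with h1 h2 h3
    · rw [evalL, evalL_merge hp v M nv n, evalL, evalL]; ring
    · rw [evalL, evalL_merge hp v M nv n, evalL, evalL]; ring
    · have hxy : y = x := le_antisymm (not_lt.mp h2) (not_lt.mp h1)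
      subst hxy
      rw [evalL_merge hp v M nv n, evalL, evalL]
      have h4 : ((c : K) + (d : K)) = 0 := by
        have := natCast_mod hp (c + d); rw [h3] at this; push_cast at this; linear_combination -this
      linear_combination (-(monoEval v M nv 0 y)) * h4
    · have hxy : y = x := le_antisymm (not_lt.mp h2) (not_lt.mp h1)
      subst hxy
      rw [evalL, evalL_merge hp v M nv n, evalL, evalL, natCast_mod hp]
      push_cast; ring

/-- `smul` multiplies the evaluation by the term. [folklore] -/
private theorem evalL_smul (hp : (p : K) = 0) (hp0 : 0 < p) (v : ℕ → K) (M nv : ℕ) (c : ℤ) (x : ℕ)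
    (hx : digitsLT M (M / 2) nv x = true) : ∀ G : List T, wfT M nv G = true →
    evalL v M nv (smul p c x G) = (c : K) * monoEval v M nv 0 x * evalL v M nv G
  | [], _ => by simp [smul, evalL]
  | (d, y) :: gs, hG => by
    simp only [wfT, Bool.and_eq_true] at hG
    rw [smul, evalL, evalL, evalL_smul hp hp0 v M nv c x hx gs hG.2, intCast_emod_toNat hp hp0,
      monoEval_add v M nv 0 x y hx hG.1]
    push_cast; ring

/-- `prodsE` accumulates `G · E`. [folklore] -/
private theorem evalLL_prodsE (hp : (p : K) = 0) (hp0 : 0 < p) (v : ℕ → K) (M nv : ℕ) (G : List T)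
    (hG : wfT M nv G = true) : ∀ (es : List (ℤ × ℕ)) (acc : List (List T)), wfE M nv es = true →
    evalLL v M nv (prodsE p G es acc) = evalL v M nv G * evalE v M nv es + evalLL v M nv acc
  | [], acc, _ => by simp [prodsE, evalE]
  | (c, x) :: es, acc, hes => by
    simp only [wfE, Bool.and_eq_true] at hes
    rw [prodsE, evalLL_prodsE hp hp0 v M nv G hG es _ hes.2, evalLL, evalE, evalL_smul hp hp0 v M nv c x hes.1 G hG]
    ring

/-- `prods` lists all the products `G_j · E_j`. [folklore] -/
private theorem evalLL_prods (hp : (p : K) = 0) (hp0 : 0 < p) (v : ℕ → K) (M nv X : ℕ) :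
    ∀ pairs : List (List ℕ × List (ℤ × ℕ)), wfPairs M nv X pairs = true →
    evalLL v M nv (prods p X pairs) = evalPairs v M nv X pairs
  | [], _ => by simp [prods, evalLL, evalPairs]
  | (g, e) :: rest, h => by
    simp only [wfPairs, Bool.and_eq_true] at h
    rw [prods, evalLL_prodsE hp hp0 v M nv _ h.1.1 e _ h.1.2, evalLL_prods hp hp0 v M nv X rest h.2, evalPairs]

/-- a round of pairwise merges preserves the total evaluation. [folklore] -/
private theorem evalLL_mergePairs (hp : (p : K) = 0) (v : ℕ → K) (M nv fuel : ℕ) :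
    ∀ ls : List (List T), evalLL v M nv (mergePairs p fuel ls) = evalLL v M nv ls
  | [] => rfl
  | [a] => rfl
  | a :: b :: rest => by
    rw [mergePairs, evalLL, evalLL, evalLL, evalL_merge hp, evalLL_mergePairs hp v M nv fuel rest]; ring

/-- balanced merging preserves the total evaluation (when the fuel suffices). [folklore] -/
private theorem evalL_mergeAll (hp : (p : K) = 0) (v : ℕ → K) (M nv fuel : ℕ) :
    ∀ n (ls : List (List T)), mergeAll p fuel n ls ≠ [] → evalL v M nv (mergeAll p fuel n ls) = evalLL v M nv ls
  | 0, ls, h => absurd rfl h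
  | n + 1, [], h => absurd rfl h
  | n + 1, [a], _ => by simp [mergeAll, evalLL]
  | n + 1, a :: b :: rest, h => by
    rw [mergeAll] at h ⊢
    rw [evalL_mergeAll hp v M nv fuel n _ h, evalLL_mergePairs hp]

/-- if every `E_j` vanishes then so does `Σ_j G_j E_j`. [folklore] -/
private theorem evalPairs_eq_zero (v : ℕ → K) (M nv X : ℕ) : ∀ pairs : List (List ℕ × List (ℤ × ℕ)),
    (∀ pr ∈ pairs, evalE v M nv pr.2 = 0) → evalPairs v M nv X pairs = 0
  | [], _ => rfl
  | (g, e) :: rest, h => by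
    rw [evalPairs, h (g, e) (by simp), evalPairs_eq_zero v M nv X rest fun pr hpr => h pr (by simp [hpr])]
    ring

/-- soundness of `check`: the target monomial vanishes at every solution of the system. [folklore] -/
private theorem monoEval_eq_zero_of_check (hp : (p : K) = 0) (hp0 : 0 < p) {fuel M nv xt : ℕ}
    {pairs : List (List ℕ × List (ℤ × ℕ))} (hchk : check p fuel M nv pairs xt = true) (v : ℕ → K)
    (hE : ∀ pr ∈ pairs, evalE v M nv pr.2 = 0) : monoEval v M nv 0 xt = 0 := by
  simp only [check, Bool.and_eq_true, beq_iff_eq] at hchk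
  obtain ⟨hwf, hres⟩ := hchk
  have hne : mergeAll p fuel 64 (prods p (M ^ nv) pairs) ≠ [] := by rw [hres]; simp
  have h1 := evalL_mergeAll hp v M nv fuel 64 _ hne
  rw [hres, evalLL_prods hp hp0 v M nv _ pairs hwf, evalPairs_eq_zero v M nv _ pairs hE, evalL, evalL] at h1
  simpa using h1

end Eval

/-- "Scenario closed": the equations `ers` (packed, base `64`, on `t` variables) have no common solution
`v` in `K` with `v 0, …, v (t-1)` all nonzero. [cite: CastryckLaterveerOunaies2012, Sec. 2] -/
def ScenClosed (K : Type*) [CommRing K] (t : ℕ) (ers : List (List (ℤ × ℕ))) : Prop :=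
  ∀ v : ℕ → K, (∀ i < t, v i ≠ 0) → (∀ er ∈ ers, evalE v 64 t er = 0) → False

/-- A kernel-checked certificate closes a scenario: if the normal form of `Σ_j G_j E_j` modulo `p` is
`x_tv ^ k`, the system `E_j = 0` has no solution with nonzero coordinates in characteristic `p`.
[cite: CastryckLaterveerOunaies2012, Sec. 2] -/
theorem scenClosed_of_check {K : Type*} [Field K] {p fuel t tv k : ℕ}
    {pairs : List (List ℕ × List (ℤ × ℕ))} {ers : List (List (ℤ × ℕ))}
    (hers : pairs.map Prod.snd = ers) (hchk : check p fuel 64 t pairs (k * 64 ^ tv) = true)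
    (htv : tv < t) (hk : 0 < k) (hk' : k < 64) (hp0 : 0 < p) (hp : (p : K) = 0) : ScenClosed K t ers := by
  intro v hv hE
  have hE' : ∀ pr ∈ pairs, evalE v 64 t pr.2 = 0 := fun pr hpr =>
    hE pr.2 (hers ▸ List.mem_map_of_mem (f := Prod.snd) hpr)
  have h := monoEval_eq_zero_of_check hp hp0 hchk v hE'
  rw [monoEval_single v (by norm_num) hk' t 0 tv htv, zero_add] at h
  exact hv tv htv (pow_eq_zero_iff hk.ne' |>.mp h)

end Literature.Algebra.Polynomial.CasasAlvero.CertCheck
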